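import Literature.MathematicalPhysics.QuantumFieldTheory.Balaban1983to89.B8Ineq159CurvedCubeMemberLocal
import Literature.MathematicalPhysics.QuantumFieldTheory.Balaban1983to89.B8Ineq159GaugeCovariance
import Literature.MathematicalPhysics.QuantumFieldTheory.Balaban1983to89.B8Lemma1NonAbelian

/-!
# `Balaban1983to89.B8Ineq159CurvedCubeMemberSmallPlaquettes` — [Balaban1985RegularSpaces] (1.59) p. 86 AT A SMALL-FIELD BACKGROUND ON THE CUBE MEMBER, PER
# MEMBER, truncation `m = 1`: for every unit-bounded background whose PLAQUETTE variables are `a₀(□)`-close to `1` on a box around `□₀` — p. 77's class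
# `𝔄_k(α₀)` read on a neighbourhood of `Ω₀ = □₀`, via Lemma 1 p. 79's axial gauge ([Balaban1985Averaging] p. 24) — the curved data dominate `|φ|`, `|D^η_{U₀}φ|`,
# `|Δ^η_{U₀}φ|` on the sides of `□_j` (file (G): composition of (F) locality, (E) gauge covariance and `B8Lemma1NonAbelian.axial_bond_bound_sharp`)

statement-level skeleton of published theorems with citation tags; proofs where landed; nothing here is a claim about the
Yang–Mills mass gap

`[Balaban1985RegularSpaces]` ("B8", CMP **99** (1985) 75–102) p. 77 (`𝔄_k({Ω_j}, α₀)`), (1.7) p. 77, (1.11) p. 78, Lemma 1 p. 79, (1.38) p. 82, (1.59) p. 86, (1.62) p. 87,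
(1.131) p. 99; [B7] = `[Balaban1985Averaging]` (CMP **98** (1985) 17–51) p. 24 (axial gauge, «|V₀(b) − 1| < |b₋ − y|α₀»), (11) p. 19; [4] =
`[Balaban1985BackgroundPropagators]` Thm 3.3 p. 399, (3.32) p. 395.

CITATION HEADER (lean-in-tree rule).  Cell `pub-ymgap` (YM Track A, HUMAN RULING D-0062 ∕ D-0149), DAG node N05 = [B8], width seat `pub-ymgap-dag-n05-w3`
(g2), CLAIM-1 file (G) — the composition announced (and deliberately not filed) in INTENT-8; filed as its own INTENT.  WHY.  The chain (A)–(F) of this seat gives the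
per-member curved (1.59) for backgrounds `δ₀`-close to `1` BONDWISE on the box `□₀ + (L+3)` ((F)), and the gauge covariance of the whole package ((E)).  Print's
hypothesis is on PLAQUETTES (p. 77), made bondwise by an axial gauge (Lemma 1 p. 79 ∕ [B7] p. 24), which the tree has as
`B8Lemma1NonAbelian.axial_bond_bound_sharp` (`‖V^{axial}(x, μ) − 1‖ ≤ l1(·)·a` on a box with `a`-small plaquettes).  THIS FILE composes the three.

THE MATHEMATICS (kernel-checked).  §1 `gaugeAct_inv_gaugeAct` (`(V^u)^{u⁻¹} = V`), `l1_le_of_le` (monotonicity of `|·|₁` on the positive cone), and ★ the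
transfer of file (F) along a gauge transformation `exists_curved159_perCube_truncOne_local_gauge` (file (E)'s §4 argument run on (F): data and targets are
rotated by unit-bounded `R(·)`, the Landau condition by `isLandau138_gaugeAct_iff`, the averages by `linCovIter_rot`).  §2 ★★★ `exists_curved159_perCube_smallPlaquettes`:
THERE ARE `a₀(□) > 0`, `B′(□) > 0` such that for every `U1`-valued `U₀` with `‖U₀(∂p) − 1‖ ≤ a₀` for the plaquettes of the box `[sqLo₀ − (L+4)𝟙, sqHi₀ + (L+4)𝟙]`
(`B8Lemma1NonAbelian.PlaqSmall`), every `φ` in the curved Landau gauge (1.38) of `U₀` at truncation `1` with the support clause, and every `N ≥ 0` bounding the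
curved data (i)–(iii): `(Lʲη)|φ|, (Lʲη)²|D^η_{U₀}φ_τ|, (Lʲη)³|Δ^η_{U₀}φ_τ| ≤ B′N` on the sides of `□_j`, `j ≤ 1`.  PROOF: `V := U₀^{w}`, `w` the axial gauge function based at the
box corner, is `l1(box)·a₀ ≤ δ₀(□)`-close to `1` on the box's bonds (`axial_bond_bound_sharp`); `U₀ = V^{w⁻¹}`; §1 at `(w⁻¹, V)`.

HONEST SCOPE ∕ A6.  PER MEMBER: `a₀(□), B′(□)` depend on the member and `𝔸`, NOT explicit, NOT print's uniform `α₀`, `B₀(d, L)`; truncation `m = 1`; the plaquette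
box `□₀ + (L+4)` is a NEIGHBOURHOOD of `Ω₀ = □₀` — print's `𝔄_k({□_j}, α₀)` constrains only the plaquettes touching `□₀` (and the level weights `α₀L^{−2j}` on
`□_j`), so this is «`𝔄`-type on a collar-enlarged top cube», NOT `InAk` verbatim and NOT an inhabitant of `SockB9P3` ∕ `SockH59` as typed; nothing of [4] Thm 3.3's
uniformity or random-walk expansion.  Non-vacuity: `U₀ = 1`, `φ = 0` (and every flat-Landau `φ`) satisfy the hypotheses.  Count-neutral; N05 NOT discharged; no count
claim; one finite `𝕋⁴` programme at fixed `ε`, Bałaban as printed; the YM mass gap (Clay) is NOT proved by any of this — R4 closes the conditional finite-`𝕋⁴` rung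
`BalabanLadder.UV` only; nothing continuum ∕ ℝ⁴ ∕ OS.  No `sorry`, no `def`, no `instance`, no `notation`.  Unit `pub-ymgap-dag-n05-w3` (g2), 2026-08-28.
-/

noncomputable section

namespace Literature.MathematicalPhysics.QuantumFieldTheory.Balaban1983to89.B8Ineq159CurvedCubeMemberSmallPlaquettes

open B7Prop1Explicit B7Prop2Explicit B7Prop1Local
open B7Eq78Linearization (conjR conjR_apply conjR_smul)
open B7Prop4GeneralLevels (linCovIter)
open B8Ineq132 (covDerivFwd covDeriv BondTouches norm_conjR)
open B8Eq140Level (SideTouches)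
open B8Eq146AExpansion (iEta)
open B8Eq155JBound (Jcur)
open B8Eq138LandauZd (IsLandau138 covLap covDivB QT)
open B8Eq131Cubes (sqLo sqHi)
open B8Eq131CubesAdmissible (cubeFam)
open B8CubeMemberZd (cubeLamS)
open B8Ineq159FlatCubeMemberPrinted (cubeLamBP)
open B8Lemma1NonAbelian (lowPart axial_bond_bound_sharp)
open B9Eq340HolderZd (covDerivFwd_gaugeAct)
open B9Eq332FieldAvgCovariance (linCovIter_rot)
open B9Eq332AvgCovariance (conjR_inv_conjR)
open B8Ineq159GaugeCovariance (Jcur_gaugeAct covLap_gaugeAct isLandau138_gaugeAct_iff)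
open B8Ineq159CurvedCubeMemberLocal (exists_curved159_perCube_truncOne_local)

export B7Prop1Explicit (Site)

variable {d : ℕ} {𝔸 : Type*} [NormedRing 𝔸] [NormOneClass 𝔸] [NormedAlgebra ℂ 𝔸] [CompleteSpace 𝔸]

/-! ## §1 Bookkeeping: the inverse gauge transformation, `|·|₁` monotone, and file (F) along a gauge transformation -/

omit [NormOneClass 𝔸] [NormedAlgebra ℂ 𝔸] [CompleteSpace 𝔸] in
/-- `(V^u)^{u⁻¹} = V` (gauge transformations act). [cite: Balaban1985RegularSpaces, (1.11) p.78; Balaban1985Averaging, (11) p.19] -/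
theorem gaugeAct_inv_gaugeAct (u : Site d → 𝔸ˣ) (V : Site d → Fin d → 𝔸ˣ) : gaugeAct u⁻¹ (gaugeAct u V) = V := by
  funext x μ
  simp only [gaugeAct, Pi.inv_apply, inv_inv]
  group

omit [NormOneClass 𝔸] [NormedAlgebra ℂ 𝔸] [CompleteSpace 𝔸] in
/-- `|·|₁` is monotone on the positive cone: `0 ≤ v ≤ w ⇒ |v|₁ ≤ |w|₁`. [folklore] [cite: Balaban1985Averaging, (14) p.19] -/
theorem l1_le_of_le {v w : Site d} (hv : 0 ≤ v) (hvw : v ≤ w) : l1 v ≤ l1 w := by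
  unfold l1
  refine Finset.sum_le_sum fun κ _ => ?_
  have h0 : 0 ≤ v κ := hv κ
  have h1 : v κ ≤ w κ := hvw κ
  have hw : 0 ≤ w κ := h0.trans h1
  have : ((v κ).natAbs : ℤ) ≤ ((w κ).natAbs : ℤ) := by
    rw [Int.natAbs_of_nonneg h0, Int.natAbs_of_nonneg hw]; exact h1
  exact_mod_cast this

/-- ★ **File (F) along a gauge transformation**: with the same `δ₀(□), B′(□)`, for every `U1`-valued gauge function `u` and every `U1`-valued `V` that is
`δ₀`-close to `1` on the bonds based in `[sqLo₀ − (L+3)𝟙, sqHi₀ + (L+3)𝟙]`, file (F)'s conclusion holds at the background `V^u` (transport `φ ↦ R(u)⁻¹φ`: the data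
and targets are rotated by unit-bounded `R(·)`, `B8Ineq132.norm_conjR`; the Landau condition by `isLandau138_gaugeAct_iff`; the averages by `linCovIter_rot`).
[cite: Balaban1985RegularSpaces, (1.59) p.86, p.77, (1.11) p.78, (1.38) p.82; Balaban1985BackgroundPropagators, (3.32) p.395; Balaban1985Averaging, (11) p.19] -/
theorem exists_curved159_perCube_truncOne_local_gauge [FiniteDimensional ℂ 𝔸] (hd2 : 2 ≤ d) {L : ℕ} (hL : 1 ≤ L) {η : ℝ} (hη : 0 < η)
    (a : Site d) (M : ℕ) {ρ : ℕ} (hρ : L ≤ ρ) {k : ℕ} (hk : 1 ≤ k) :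
    ∃ δ₀ B' : ℝ, 0 < δ₀ ∧ 0 < B' ∧ ∀ (u : Site d → 𝔸ˣ), (∀ x, u x ∈ U1 𝔸) →
      ∀ (V : Site d → Fin d → 𝔸ˣ), (∀ x κ, V x κ ∈ U1 𝔸) →
      (∀ (x : Site d) (κ : Fin d),
          InBox (sqLo L a ρ k 0 - ((L : ℤ) + 3) • (1 : Site d)) (sqHi L a M ρ k 0 + ((L : ℤ) + 3) • (1 : Site d)) x →
          ‖((V x κ : 𝔸ˣ) : 𝔸) - 1‖ ≤ δ₀) →
      ∀ φ : Site d → Fin d → 𝔸,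
        IsLandau138 L 1 η (cubeFam false L a M ρ k 0) (cubeLamS L a M ρ k 1) (gaugeAct u V) φ →
        (∀ (y : Site d) (τ : Fin d), (∀ j, j ≤ 1 → ¬ SideTouches (cubeFam false L a M ρ k j) y τ) → φ y τ = 0) →
        ∀ N : ℝ, 0 ≤ N →
          (∀ j, j ≤ 1 → ∀ (y : Site d) (τ : Fin d), BondTouches (cubeFam false L a M ρ k j) y τ →
              ((L : ℝ) ^ j * η) ^ 3 * ‖Jcur η (gaugeAct u V) φ τ y‖ ≤ N) →
          (∀ j, j ≤ 1 → ∀ c ∈ cubeLamBP L a M ρ k 1 j, ‖linCovIter L (gaugeAct u V) (iEta η φ) j c.1 c.2‖ ≤ N) →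
          (∀ (y : Site d) (τ : Fin d), ¬ BondTouches (cubeFam false L a M ρ k 0) y τ → η * ‖φ y τ‖ ≤ N) →
          ∀ j, j ≤ 1 → ∀ (y : Site d) (τ : Fin d), SideTouches (cubeFam false L a M ρ k j) y τ →
            ((L : ℝ) ^ j * η) * ‖φ y τ‖ ≤ B' * N ∧
            (∀ ν : Fin d, ((L : ℝ) ^ j * η) ^ 2 * ‖covDerivFwd η (gaugeAct u V) ν (fun z => φ z τ) y‖ ≤ B' * N) ∧
            ((L : ℝ) ^ j * η) ^ 3 * ‖covLap η (gaugeAct u V) (fun z => φ z τ) y‖ ≤ B' * N := by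
  obtain ⟨δ₀, B', hδ₀, hB', H⟩ := exists_curved159_perCube_truncOne_local (𝔸 := 𝔸) hd2 hL hη a M hρ hk
  refine ⟨δ₀, B', hδ₀, hB', ?_⟩
  intro u hu V hV hδ φ hLan hs N hN h1 h2 h3 j hj y τ hst
  set A : Site d → Fin d → 𝔸 := fun z κ => conjR (u z)⁻¹ (φ z κ) with hA
  have hφA : φ = fun z κ => conjR (u z) (A z κ) := by
    funext z κ
    rw [hA]
    exact (conjR_inv_conjR (u z)⁻¹ (φ z κ)).symm.trans (by rw [inv_inv])
  have hnA : ∀ z κ, ‖A z κ‖ = ‖φ z κ‖ := fun z κ => by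
    rw [hA]; exact norm_conjR ((U1 𝔸).inv_mem (hu z)) _
  have hLanA : IsLandau138 L 1 η (cubeFam false L a M ρ k 0) (cubeLamS L a M ρ k 1) V A := by
    rw [hφA] at hLan
    exact (isLandau138_gaugeAct_iff L u V 1 η _ _ A).1 hLan
  have hsA : ∀ (y : Site d) (τ : Fin d), (∀ j, j ≤ 1 → ¬ SideTouches (cubeFam false L a M ρ k j) y τ) → A y τ = 0 := by
    intro y' τ' h
    rw [hA]
    show conjR (u y')⁻¹ (φ y' τ') = 0
    rw [hs y' τ' h, conjR_apply, mul_zero, zero_mul]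
  have h1A : ∀ j, j ≤ 1 → ∀ (y : Site d) (τ : Fin d), BondTouches (cubeFam false L a M ρ k j) y τ →
      ((L : ℝ) ^ j * η) ^ 3 * ‖Jcur η V A τ y‖ ≤ N := by
    intro j' hj' y' τ' hbt
    have e : ‖Jcur η (gaugeAct u V) φ τ' y'‖ = ‖Jcur η V A τ' y'‖ := by
      rw [hφA, Jcur_gaugeAct]; exact norm_conjR (hu y') _
    rw [← e]; exact h1 j' hj' y' τ' hbt
  have h2A : ∀ j, j ≤ 1 → ∀ c ∈ cubeLamBP L a M ρ k 1 j, ‖linCovIter L V (iEta η A) j c.1 c.2‖ ≤ N := by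
    intro j' hj' c hc
    have hi : iEta η φ = fun z κ => conjR (u z) (iEta η A z κ) := by
      funext z κ
      rw [hφA]
      simp only [B8Eq146AExpansion.iEta_def, conjR_smul]
    have e : ‖linCovIter L (gaugeAct u V) (iEta η φ) j' c.1 c.2‖ = ‖linCovIter L V (iEta η A) j' c.1 c.2‖ := by
      rw [hi, linCovIter_rot]
      exact norm_conjR (hu _) _
    rw [← e]; exact h2 j' hj' c hc
  have h3A : ∀ (y : Site d) (τ : Fin d), ¬ BondTouches (cubeFam false L a M ρ k 0) y τ → η * ‖A y τ‖ ≤ N := by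
    intro y' τ' h; rw [hnA]; exact h3 y' τ' h
  obtain ⟨t1, t2, t3⟩ := H V hV hδ A hLanA hsA N hN h1A h2A h3A j hj y τ hst
  refine ⟨by rw [← hnA]; exact t1, fun ν => ?_, ?_⟩
  · have e : ‖covDerivFwd η (gaugeAct u V) ν (fun z => φ z τ) y‖ = ‖covDerivFwd η V ν (fun z => A z τ) y‖ := by
      rw [covDerivFwd_gaugeAct η u V ν (F := fun z => A z τ) (fun z => by rw [hφA])]
      exact norm_conjR (hu y) _
    rw [e]; exact t2 ν
  · have e : ‖covLap η (gaugeAct u V) (fun z => φ z τ) y‖ = ‖covLap η V (fun z => A z τ) y‖ := by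
      have hfun : (fun z => φ z τ) = fun z => conjR (u z) (A z τ) := by funext z; rw [hφA]
      rw [hfun, covLap_gaugeAct]
      exact norm_conjR (hu y) _
    rw [e]; exact t3

/-! ## §2 The per-member curved (1.59) for backgrounds with small plaquettes on a box around `□₀` -/

/-- ★★★ **(1.59) AT A SMALL-FIELD BACKGROUND ON THE CUBE MEMBER, PER MEMBER, TRUNCATION `m = 1`.**  For `d ≥ 2`, `1 ≤ L ≤ ρ`, `η > 0`, a cube datum `(a, M, ρ, k)`
with `k ≥ 1`, and `𝔸` a finite-dimensional complete normed `ℂ`-algebra, THERE ARE `a₀ > 0` and `B′ > 0` (depending on the member and `𝔸`) such that: for every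
`U1`-valued background `U₀` whose plaquette variables on the box `[sqLo₀ − (L+4)𝟙, sqHi₀ + (L+4)𝟙]` are `a₀`-close to `1` (`PlaqSmall U₀ lo hi a₀`, p. 77's (1.7) on a
neighbourhood of `□₀`), every `𝔸`-valued `φ` in the CURVED Landau gauge (1.38) of `U₀` at truncation `1` supported on the side-touching bonds of `□₀ ∕ □₁`, and every
`N ≥ 0` bounding (i) `(Lʲη)³|J_{U₀}(φ)|` on the bonds of `□_j`, (ii) the curved averages `|Lʲη·Q_j(U₀)(iηφ)(c)|` on print's class, (iii) `η|φ|` on the outer layer —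
on every bond side-touching `□_j` (`j ≤ 1`): `(Lʲη)|φ| ≤ B′N`, `(Lʲη)²|D^η_{U₀,ν}φ_τ| ≤ B′N`, `(Lʲη)³|Δ^η_{U₀}φ_τ| ≤ B′N`.  PROOF: Lemma 1's axial gauge `w` based at the
box corner makes `U₀^w` bondwise `l1(box)·a₀ ≤ δ₀(□)`-close to `1` on the box (`axial_bond_bound_sharp`); `U₀ = (U₀^w)^{w⁻¹}`; §1.  HONEST SCOPE: per member,
`m = 1`, plaquettes on a box ⊋ `□₀` (not `𝔄_k` verbatim), not a socket inhabitant, not [4] Thm 3.3.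
[cite: Balaban1985RegularSpaces, (1.59) p.86, (1.62) p.87, p.77, (1.7) p.77, Lemma 1 p.79, (1.38) p.82, (1.131) p.99; Balaban1985Averaging, p.24; Balaban1985BackgroundPropagators, Thm 3.3 p.399, (3.32) p.395] -/
theorem exists_curved159_perCube_smallPlaquettes [FiniteDimensional ℂ 𝔸] (hd2 : 2 ≤ d) {L : ℕ} (hL : 1 ≤ L) {η : ℝ} (hη : 0 < η)
    (a : Site d) (M : ℕ) {ρ : ℕ} (hρ : L ≤ ρ) {k : ℕ} (hk : 1 ≤ k) :
    ∃ a₀ B' : ℝ, 0 < a₀ ∧ 0 < B' ∧ ∀ (U₀ : Site d → Fin d → 𝔸ˣ), (∀ x κ, U₀ x κ ∈ U1 𝔸) →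
      B8Lemma1NonAbelian.PlaqSmall U₀ (sqLo L a ρ k 0 - ((L : ℤ) + 4) • (1 : Site d)) (sqHi L a M ρ k 0 + ((L : ℤ) + 4) • (1 : Site d)) a₀ →
      ∀ φ : Site d → Fin d → 𝔸,
        IsLandau138 L 1 η (cubeFam false L a M ρ k 0) (cubeLamS L a M ρ k 1) U₀ φ →
        (∀ (y : Site d) (τ : Fin d), (∀ j, j ≤ 1 → ¬ SideTouches (cubeFam false L a M ρ k j) y τ) → φ y τ = 0) →
        ∀ N : ℝ, 0 ≤ N →
          (∀ j, j ≤ 1 → ∀ (y : Site d) (τ : Fin d), BondTouches (cubeFam false L a M ρ k j) y τ →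
              ((L : ℝ) ^ j * η) ^ 3 * ‖Jcur η U₀ φ τ y‖ ≤ N) →
          (∀ j, j ≤ 1 → ∀ c ∈ cubeLamBP L a M ρ k 1 j, ‖linCovIter L U₀ (iEta η φ) j c.1 c.2‖ ≤ N) →
          (∀ (y : Site d) (τ : Fin d), ¬ BondTouches (cubeFam false L a M ρ k 0) y τ → η * ‖φ y τ‖ ≤ N) →
          ∀ j, j ≤ 1 → ∀ (y : Site d) (τ : Fin d), SideTouches (cubeFam false L a M ρ k j) y τ →
            ((L : ℝ) ^ j * η) * ‖φ y τ‖ ≤ B' * N ∧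
            (∀ ν : Fin d, ((L : ℝ) ^ j * η) ^ 2 * ‖covDerivFwd η U₀ ν (fun z => φ z τ) y‖ ≤ B' * N) ∧
            ((L : ℝ) ^ j * η) ^ 3 * ‖covLap η U₀ (fun z => φ z τ) y‖ ≤ B' * N := by
  obtain ⟨δ₀, B', hδ₀, hB', H⟩ := exists_curved159_perCube_truncOne_local_gauge (𝔸 := 𝔸) hd2 hL hη a M hρ hk
  -- the plaquette box and its `|·|₁`-diameter
  obtain ⟨lo, hlo⟩ : ∃ lo : Site d, lo = sqLo L a ρ k 0 - ((L : ℤ) + 4) • (1 : Site d) := ⟨_, rfl⟩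
  obtain ⟨hi, hhi⟩ : ∃ hi : Site d, hi = sqHi L a M ρ k 0 + ((L : ℤ) + 4) • (1 : Site d) := ⟨_, rfl⟩
  have hlo_i : ∀ i, lo i = sqLo L a ρ k 0 i - (L + 4) := fun i => by
    rw [hlo]; simp only [Pi.sub_apply, Pi.smul_apply, Pi.one_apply, smul_eq_mul, mul_one]
  have hhi_i : ∀ i, hi i = sqHi L a M ρ k 0 i + (L + 4) := fun i => by
    rw [hhi]; simp only [Pi.add_apply, Pi.smul_apply, Pi.one_apply, smul_eq_mul, mul_one]
  obtain ⟨D, hD⟩ : ∃ D : ℕ, D = l1 (hi - lo) := ⟨_, rfl⟩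
  obtain ⟨a₀, ha₀⟩ : ∃ a₀ : ℝ, a₀ = δ₀ / ((D : ℝ) + 1) := ⟨_, rfl⟩
  have ha₀pos : 0 < a₀ := by rw [ha₀]; positivity
  have hDa : (D : ℝ) * a₀ ≤ δ₀ := by
    rw [ha₀, mul_div_assoc']
    rw [div_le_iff₀ (by positivity)]
    nlinarith [hδ₀.le]
  refine ⟨a₀, B', ha₀pos, hB', ?_⟩
  intro U₀ hU hP φ hLan hs N hN h1 h2 h3 j hj y τ hst
  rw [← hlo, ← hhi] at hP
  -- Lemma 1's axial gauge based at the corner `lo`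
  set w : Site d → 𝔸ˣ := axialFn U₀ lo with hw
  have hwU : ∀ x, w x ∈ U1 𝔸 := fun x => axialFn_mem hU lo x
  set V : Site d → Fin d → 𝔸ˣ := gaugeAct w U₀ with hVdef
  have hV : ∀ x κ, V x κ ∈ U1 𝔸 := fun x κ => gaugeAct_mem hU hwU x κ
  have hUV : U₀ = gaugeAct w⁻¹ V := by rw [hVdef, gaugeAct_inv_gaugeAct]
  -- `V` is `δ₀`-close to `1` on the bonds based in the (smaller) box of file (F)
  have hclose : ∀ (x : Site d) (κ : Fin d),
      InBox (sqLo L a ρ k 0 - ((L : ℤ) + 3) • (1 : Site d)) (sqHi L a M ρ k 0 + ((L : ℤ) + 3) • (1 : Site d)) x →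
      ‖((V x κ : 𝔸ˣ) : 𝔸) - 1‖ ≤ δ₀ := by
    intro x κ hx
    have hx' : ∀ i, sqLo L a ρ k 0 i - (L + 3) ≤ x i ∧ x i ≤ sqHi L a M ρ k 0 i + (L + 3) := fun i => by
      have := hx i
      simp only [Pi.sub_apply, Pi.add_apply, Pi.smul_apply, Pi.one_apply, smul_eq_mul, mul_one] at this
      exact this
    have hlox : lo ≤ x := fun i => by rw [hlo_i]; linarith [(hx' i).1]
    have hxhi : x + e κ ≤ hi := fun i => by
      rw [hhi_i, Pi.add_apply, e_apply]; split_ifs <;> linarith [(hx' i).2]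
    have hb := axial_bond_bound_sharp U₀ hU hP lo x κ le_rfl hlox hxhi
    have hl1 : (l1 (lowPart κ (x - lo)) : ℝ) ≤ D := by
      rw [hD]
      exact_mod_cast l1_le_of_le (B8Lemma1NonAbelian.lowPart_nonneg κ (sub_nonneg.mpr hlox))
        ((B8Lemma1NonAbelian.lowPart_le_self κ (sub_nonneg.mpr hlox)).trans (fun i => by
          have h1 := hxhi i
          have h2 : (0 : ℤ) ≤ e κ i := by rw [e_apply]; split_ifs <;> norm_num
          rw [Pi.add_apply] at h1
          simp only [Pi.sub_apply]
          linarith))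
    calc ‖((V x κ : 𝔸ˣ) : 𝔸) - 1‖ ≤ l1 (lowPart κ (x - lo)) * a₀ := hb
      _ ≤ D * a₀ := mul_le_mul_of_nonneg_right hl1 ha₀pos.le
      _ ≤ δ₀ := hDa
  -- file (F) along the inverse axial gauge
  rw [hUV] at hLan h1 h2 ⊢
  exact H w⁻¹ (fun x => (U1 𝔸).inv_mem (hwU x)) V hV hclose φ hLan hs N hN h1 h2 h3 j hj y τ hst

end Literature.MathematicalPhysics.QuantumFieldTheory.Balaban1983to89.B8Ineq159CurvedCubeMemberSmallPlaquettes

end
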